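import Literature.AlgebraicGeometry.Hu2025.Statements.S01S09Interface.R110fSetupOurs
import Mathlib.AlgebraicGeometry.AffineSpace
import HarnessLib

/-!
# [Hu22] p.131 (proof of Thm 9.5): the setting (9.2)/(9.3) WITH the printed torus-quotient data of Thm 9.4, the sentence
# P131L40 over it, and the sentence p.132 l.30–45 ((9.4): `π` is Zariski-locally trivial with fibre the split torus) —
# row 110 file `g` = `S01S09Interface/R110gSetupPrinted.lean`, STATEMENTS-FIRST (rung M-Hu-min, D-0089). res-type-024 gen 12.

**Status of the sources (D-0012): UNREFEREED PREPRINTS UNDER ADJUDICATION.** [Hu22] = Y. Hu, arXiv:2203.03842v4 (2022),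
pp.130–132 (page texts `p0130.txt`–`p0132.txt`, re-read this session); [Hu25] = arXiv:2507.21400v1, chunk p0072 (Prop. 9.1
l.71–82, Thm 9.4 l.118–124). WHY THIS FILE: lane A (res-ref-a10, ref/lane-A/LEDGER.tsv rows of 2026-08-27T09:54:49Z on file e
p518378) signed `Hu22Setup` / `Hu22P131L40` PARTIAL — the literal record `Hu22Setup` (file e) keeps the diagram (9.2)/(9.3) but
types (a) «`U ≅ Gr̄_d = Gr_d/(𝔾ⁿ_m/𝔾_m)`», «the quotient map `π`» only as `quot_surjective`, and (b) «the matroid Schubert cell …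
is an open subset of `Z_Γ`» only as SOME open immersion; file f (`Hu22Setup_ours`, p520063) added (b) as `range_cellToGamma`.
Accepted files are never edited, so THIS FILE adds, next to e and f (all three stay on record):
* `Hu22Setup_printed L 𝔽 n d` = `Hu22Setup_ours` (hence (b)) + the data PRINTED in Thm 9.4 / p.131 l.4–16 that e omits:
  `X` «an affine scheme of finite type over `Spec ℤ`» (Thm 9.4 is applied to `X`, l.5), «a positive integer `r`», «`(𝔾ⁿ_m/𝔾_m)`
  acts freely on `Gr_d`» (R110c's `TorusFreeOnCell`, field-valued points), and «`U` is isomorphic to the quotient space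
  `Gr̄_d := Gr_d/(𝔾ⁿ_m/𝔾_m)`» as an isomorphism `U ≅ L.barGr n d hfree` over a datum `L : LafforgueObjects` — the idiom of
  R110c's `Thm9_4` (the lane's suggested minimal form of (a)); and «the quotient map `π : Gr_d → Gr̄_d`» (l.10–16) of that FREE
  action READ through the author's own gloss p.132 l.30–51 — «the quotient map `π` … is a principal `(𝔾ⁿ_m/𝔾_m)`-bundle …
  Zariski locally trivial … (9.4) `Gr_d|_O ≅ O × (𝔾ⁿ_m/𝔾_m)`», split `𝔾^{n−1}_m` — as the field `quot_trivialises` (= the body of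
  `Hu22P132L30` below for this datum): a finite open cover of `U` over which `quot` is isomorphic, over the base, to
  `O × 𝔾^{n−1}_m → O`. [La03]'s objects are NOT constructed in this typing (R110c): `quot ≫ isoBarGr.hom : cell ⟶ Gr̄_d` stands
  for `π` NOMINALLY, `quot_trivialises` carries the content (READING, labelled: the action and the equivariance of the
  trivialisations are not typed).
* `Hu22P131L40_printed S` = the sentence p.131 l.40–41 over that setting (one step, as printed; the two-step OURS reading is f's
  `Hu22P131L40_ours S.toHu22Setup_ours`, the literal record e's `Hu22P131L40 S.toHu22Setup`).
* `Hu22P132L30 S` = [Hu22] p.132 l.30–45 as a CLAIM over the LITERAL setting `Hu22Setup` of file e, verbatim «observe that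
  the quotient map `π : Gr_d → Gr̄_d (≅ U)` is a principal `(𝔾ⁿ_m/𝔾_m)`-bundle, and is étale locally trivial. As any étale locally trivial principal `(𝔾ⁿ_m/𝔾_m)`-bundle is Zariski
  locally trivial …, we can over [sic] `Gr̄_d (≅ U)` by a finite set `{O}` of open subsets such that for any open subset `O` in the
  cover, we have a trivialization (9.4) `Gr_d|_O ≅ O × (𝔾ⁿ_m/𝔾_m)`», with «we take a split and let `(𝔾ⁿ_m/𝔾_m) ≅ 𝔾^{n−1}_m`»
  (l.46–51): the Zariski-local triviality (9.4) of `quot` with fibre the split torus of rank `n − 1` (`splitTorusOver`); through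
  `toHu22Setup` it applies to f's `Hu22Setup_ours` and is a FIELD of `Hu22Setup_printed` (there it holds by definition); the
  torsor structure (action, equivariance of the trivialisations) is not typed — READING, labelled.
Every decl is a candidate / structure tagged `[claim: Hu2022, status: under-review]` (the split torus: OURS vocabulary), consumed
only as a hypothesis, never asserted; no proofs, no `sorry`, no `instance`, no notation. EXISTENCE of an inhabitant is NOT shown
(an inhabitant of `Hu22Setup_printed` is relative to the unconstructed datum `L`). No decl takes a side on joint J1 (tree index
only: `Hu2025/GammaSchemeNotIntegral*.lean`, `Hu2025/Proofs/S01S09Interface/GammaQuadHu22Setup(Lit).lean` are kernel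
statements about explicit data, never premises here). AI typing is weaker than expert review. Universe `0`.
STATUS: candidate statements under adjudication (D-0012/D-0089); not asserted.
-/

noncomputable section

open _root_.CategoryTheory _root_.CategoryTheory.Limits _root_.AlgebraicGeometry

namespace Literature.AlgebraicGeometry.Hu2025.Statements.S01S09Interface

open Literature.AlgebraicGeometry.Hu2025.Statements.S08MainTheorem
open Literature.AlgebraicGeometry.Hu2025.Statements.S07GammaSchemes
open Literature.AlgebraicGeometry.Hu2025.Statements.S03Pluecker

/-! ## The split torus `𝔾^k_m` over a scheme ([Hu22] p.132 l.46–51) — OURS vocabulary -/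

/-- **The split torus `O × 𝔾^k_m` over a scheme `O`** ([Hu22] p.132 l.43–51: «(9.4) `Gr_d|_O ≅ O × (𝔾ⁿ_m/𝔾_m)`. Further, we
take a split and let `(𝔾ⁿ_m/𝔾_m) ≅ 𝔾^{n−1}_m = Spec 𝔽[s^±_1, ⋯, s^±_{n−1}]`»): the open subscheme of Mathlib's affine space
`𝔸(Fin k; O)` where every coordinate `s_i` (`AffineSpace.coord O i`) is invertible, i.e. the basic open of `∏_i s_i`
(= `O ×_{Spec ℤ} Spec ℤ[s^±_1, ⋯, s^±_k]`). OURS rendering (standard) of the printed product; universe `0`.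
[claim: Hu2022, status: under-review]
STATUS: candidate statement under adjudication (D-0012/D-0089); not asserted. -/
def splitTorusOver (k : ℕ) (O : Scheme.{0}) : (𝔸(Fin k; O)).Opens :=
  (𝔸(Fin k; O)).basicOpen (∏ i : Fin k, AffineSpace.coord O i)

/-- **The projection `O × 𝔾^k_m → O`** of the split torus over `O` (same locator): the inclusion of the basic open followed
by the structure map `𝔸(Fin k; O) → O`. OURS rendering. [claim: Hu2022, status: under-review]
STATUS: candidate statement under adjudication (D-0012/D-0089); not asserted. -/
def splitTorusOverProj (k : ℕ) (O : Scheme.{0}) : (splitTorusOver k O : Scheme.{0}) ⟶ O :=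
  (splitTorusOver k O).ι ≫ (𝔸(Fin k; O) ↘ O)

/-! ## [Hu22] p.132 l.30–51 — the sentence on `π` and the trivialisations (9.4) -/

/-- **Hu 2022 (arXiv:2203.03842v4), p.132 l.30–45 with l.46–51** (proof of Thm 9.5, between P131L40 and P133L11), verbatim:
«Now, observe that the quotient map `π : Gr^{3,E}_d → Gr̄^{3,E}_d (≅ U)` is a principal `(𝔾ⁿ_m/𝔾_m)`-bundle, and is étale
locally trivial. As any étale locally trivial principal `(𝔾ⁿ_m/𝔾_m)`-bundle is Zariski locally trivial (that is, `(𝔾ⁿ_m/𝔾_m)`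
is special in the sense of Serre), we can over [sic] `Gr̄^{3,E}_d (≅ U)` by a finite set `{O}` of open subsets such that for any
open subset `O` in the cover, we have a trivialization (9.4) `Gr^{3,E}_d|_O ≅ O × (𝔾ⁿ_m/𝔾_m)`. Further, we take a split and let
`(𝔾ⁿ_m/𝔾_m) ≅ 𝔾^{n−1}_m = Spec 𝔽[s^±_1, ⋯, s^±_{n−1}]`.» Typed as the CLAIM it states about `π`, over the LITERAL setting
`S : Hu22Setup 𝔽 n d` of file e (`π` = `S.quot : cell ⟶ U`; through `toHu22Setup` it applies to f's `Hu22Setup_ours`, and it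
is the field `quot_trivialises` of `Hu22Setup_printed` below), in the form the text USES ((9.4), Zariski-local triviality
with split fibre): there are a finite index type `ι` and opens `O_j ⊂ U` covering `U` such that, for every `j`, the restriction `quot ∣_ O_j : quot⁻¹(O_j) ⟶ O_j`
is isomorphic OVER `O_j` to the projection `O_j × 𝔾^{n−1}_m ⟶ O_j` (`splitTorusOver (n − 1) O_j`). READING, labelled: the
words «principal bundle» / «étale locally trivial» (the torsor structure: the action and the equivariance of the
trivialisations) are not typed — only the cover and the trivialisations (9.4) are. [claim: Hu2022, status: under-review]
STATUS: candidate statement under adjudication (D-0012/D-0089); not asserted. -/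
def Hu22P132L30 {𝔽 : Type} [Field 𝔽] {n : ℕ} {M : HuMatroid n 3} (S : Hu22Setup 𝔽 n M) : Prop :=
  ∃ (ι : Type) (_ : Finite ι) (O : ι → (S.U : Scheme.{0}).Opens), (⨆ j, O j) = ⊤ ∧
    ∀ j, ∃ e : ((S.quot ⁻¹ᵁ (O j) : S.cell.Opens) : Scheme.{0}) ≅ (splitTorusOver (n - 1) (O j : Scheme.{0}) : Scheme.{0}),
      e.hom ≫ splitTorusOverProj (n - 1) (O j : Scheme.{0}) = S.quot ∣_ (O j)

/-! ## [Hu22] p.131 l.4–41 with Thm 9.4 (p.130 l.39–50 = [Hu25] C72L118–L124): the setting WITH the printed torus-quotient data -/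

/-- **The setting of [Hu22] p.131 l.4–41 (proof of Thm 9.5) WITH the data printed in Thm 9.4 — sibling of `Hu22Setup` (file e,
literal record) and `Hu22Setup_ours` (file f)**, answering lane A's rows of 2026-08-27T09:54:49Z ((a) «`U ≅ Gr̄_d`» / «the
quotient map `π`» and (b) «`cell` = the matroid Schubert cell» were not recorded by e). Printed text: Thm 9.4 (p.130 l.39–50;
[Hu25] chunk p0072 l.118–124) «Let `X` be an affine scheme of finite type over `Spec ℤ`. Then, there exists a matroid `d` of
rank `3` on the set `[n]` such that `(𝔾ⁿ_m/𝔾_m)` acts freely on the matroid Schubert cell `Gr^{3,E}_d`. Further, there exists a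
positive integer `r` and an open subset `U ⊂ X × 𝔸^r` projecting onto `X` such that `U` is isomorphic to the quotient space
`Gr̄^{3,E}_d := Gr^{3,E}_d/(𝔾ⁿ_m/𝔾_m)`.»; p.131 l.4–16 «First, we assume that `X` is defined over `Spec ℤ`. We apply Theorem 9.4
to `X` and follow the notations in Theorem 9.4. We identify `U ⊂ X × 𝔸^r` with the quotient space `Gr̄^{3,E}_d =
Gr^{3,E}_d/(𝔾ⁿ_m/𝔾_m)`. Consider the quotient map `π : Gr^{3,E}_d → Gr̄^{3,E}_d`.»; l.27–28 «We can apply Proposition 9.1 to the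
matroid Schubert cell» (= the inherited field `range_cellToGamma` of `Hu22Setup_ours`, [Hu25] Prop. 9.1 chunk p0072 l.71–82).
Fields beyond `Hu22Setup_ours`: `X` affine of finite type over `Spec ℤ` (R110c `IsAffineFiniteTypeOverInt`; Thm 9.4 is
applied to `X`, l.5 — the base of `X` in Thm 9.5 itself is «a perfect field `k`» with «defined over `Spec ℤ`», l.4: recorded as
printed, not reconciled here); `0 < r` («a positive integer `r`»; R110c's `Thm9_4` types `r : ℕ` only); `hfree` = «acts freely»
in R110c's field-valued-points reading `TorusFreeOnCell`; `isoBarGr : U ≅ L.barGr n d hfree` = «`U` is isomorphic to / identified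
with the quotient space `Gr̄_d`», in the idiom of R110c's `Thm9_4` over a datum `L : LafforgueObjects` (parameter, shared with
`Thm9_4 L` / `C09L16_inst L`); `quot_trivialises` = «the quotient map `π : Gr^{3,E}_d → Gr̄^{3,E}_d`» (l.10–16) of the FREE
action, READ through the author's gloss p.132 l.30–51 («`π` … is a principal `(𝔾ⁿ_m/𝔾_m)`-bundle … Zariski locally trivial …
(9.4) `Gr_d|_O ≅ O × (𝔾ⁿ_m/𝔾_m)`», split torus `𝔾^{n−1}_m`) = the body of `Hu22P132L30` for this datum: a finite open cover of `U`
over which `quot` is isomorphic over the base to `O × 𝔾^{n−1}_m → O` — READING, labelled (the action itself and the equivariance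
of the trivialisations are not typed). [La03]'s `Gr_d` and `π` are not fields of R110c's record: `quot ≫ isoBarGr.hom : cell ⟶
Gr̄_d` stands for `π` NOMINALLY, `quot_trivialises` carries the content. **EXISTENCE / CONSTRUCTION NOT SHOWN (relative to the
unconstructed `L`); secondary ([La03] via [Hu25] §9); primary unread (acq-07745).** Universe `0`.
[claim: Hu2022, status: under-review]
STATUS: candidate statement under adjudication (D-0012/D-0089); not asserted. -/
structure Hu22Setup_printed (L : LafforgueObjects) (𝔽 : Type) [Field 𝔽] (n : ℕ) (M : HuMatroid n 3)
    extends Hu22Setup_ours 𝔽 n M where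
  /-- «We apply Theorem 9.4 to `X`» (p.131 l.5): `X` is «an affine scheme of finite type over `Spec ℤ`» (p.130 l.39–40) -/
  X_thm94 : IsAffineFiniteTypeOverInt X
  /-- «there exists a positive integer `r`» (p.130 l.45–46) -/
  r_pos : 0 < r
  /-- «`(𝔾ⁿ_m/𝔾_m)` acts freely on the matroid Schubert cell `Gr^{3,E}_d`» (p.130 l.42–44; [Hu25] C72L121), READ at field-valued points (R110c) -/
  hfree : TorusFreeOnCell M
  /-- «`U` is isomorphic to the quotient space `Gr̄^{3,E}_d := Gr^{3,E}_d/(𝔾ⁿ_m/𝔾_m)`» (p.130 l.46–50) / «We identify `U ⊂ X × 𝔸^r`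
  with the quotient space» (p.131 l.6–9), over the [La03] datum `L` as in R110c's `Thm9_4` -/
  isoBarGr : (U : Scheme.{0}) ≅ L.barGr n M hfree
  /-- «the quotient map `π : Gr^{3,E}_d → Gr̄^{3,E}_d`» (p.131 l.10–16) of the free action, READ via p.132 l.30–51: «`π` … is a
  principal `(𝔾ⁿ_m/𝔾_m)`-bundle … Zariski locally trivial … a finite set `{O}` of open subsets … (9.4) `Gr_d|_O ≅ O × (𝔾ⁿ_m/𝔾_m)`»,
  split `𝔾^{n−1}_m` (READING, labelled; = `Hu22P132L30` of the underlying literal datum) -/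
  quot_trivialises : ∃ (ι : Type) (_ : Finite ι) (O : ι → (U : Scheme.{0}).Opens), (⨆ j, O j) = ⊤ ∧
    ∀ j, ∃ e : ((quot ⁻¹ᵁ (O j) : cell.Opens) : Scheme.{0}) ≅ (splitTorusOver (n - 1) (O j : Scheme.{0}) : Scheme.{0}),
      e.hom ≫ splitTorusOverProj (n - 1) (O j : Scheme.{0}) = quot ∣_ (O j)

/-- **Hu 2022 (arXiv:2203.03842v4), p.131 l.40–41 over the setting WITH the printed torus-quotient data** (joint J1 = G-H7's
printed reason; sibling of e's literal `Hu22P131L40` and f's two-step `Hu22P131L40_ours`), verbatim: «As `X` is integral (by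
assumption), one sees that `Z_Γ` is integral.» Typed as the INFERENCE it states, ONE step as printed, over
`S : Hu22Setup_printed L 𝔽 n d`: `X` integral ⇒ `Z_Γ = gammaSpec (primaryFamily n 𝔽) (Γ_d ∩ Var_𝐔)` integral (Mathlib
`IsIntegral`). The conclusion depends on `(𝔽, n, d)` only — that is the printed sentence's shape; the setting now carries Thm 9.4's
data ((a): nominally `isoBarGr` relative to `L`, with content `quot_trivialises`) and the Prop-9.1 identification of the
cell ((b)). The same sentence over the weaker records is `Hu22P131L40 S.toHu22Setup` (e) / `Hu22P131L40_ours
S.toHu22Setup_ours` (f). No side is taken on whether it follows (tree index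
only, see the module docstring). [claim: Hu2022, status: under-review]
STATUS: candidate statement under adjudication (D-0012/D-0089); not asserted. -/
def Hu22P131L40_printed {L : LafforgueObjects} {𝔽 : Type} [Field 𝔽] {n : ℕ} {M : HuMatroid n 3}
    (S : Hu22Setup_printed L 𝔽 n M) : Prop :=
  IsIntegral S.X → IsIntegral (gammaSpec (primaryFamily n 𝔽) (GammaOfMatroidVar M))

end Literature.AlgebraicGeometry.Hu2025.Statements.S01S09Interface

end
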